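import Literature.Probability.RandomPlanarGeometry.SLEImageLocalisationCell
import Literature.Probability.RandomPlanarGeometry.BrownianOscillationTail
import HarnessLib

/-!
# Gaussian tail of the driver oscillation over a cell, and moments of the running supremum on it

Support file of the bracket estimate of the locality martingale (`SLEImageBracketEstimate`; G. F. Lawler,
O. Schramm, W. Werner, Acta Math. **187** (2001), Thm. 2.2 at `κ = 6`). On the bad event
`Bad = {a ≤ osc_h(incr_u β)}` of large oscillation of the driving Brownian path over a cell of length `h`:

* `measureReal_oscFn_incr_ge_le_pow_four` — `P(Bad) ≤ 768 h⁴/a⁸` (Gaussian tail of the running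
  supremum `measure_le_runSup_le_exp`, Revuz–Yor Ch. II Prop. (1.8), and `e^{-y} ≤ 24/y⁴`, inlined);
* `integral_indicator_oscFn_mul_runSup_pow_le` — with `X = runSup (u+h)`: `E[𝟙_Bad X] ≤ 768 h³/a⁸ + 18(u+h)² h³`,
  `E[𝟙_Bad X²] ≤ 768 h²/a⁸ + 18(u+h)² h²` (`𝟙 X ≤ λ𝟙 + X⁴/λ³`, `𝟙 X² ≤ λ²𝟙 + X⁴/λ²` at `λ = 1/h` and the
  fourth moment `integral_runSup_pow_four_le`).

Theorems only.

## References

* D. Revuz, M. Yor (1999), Ch. II Prop. (1.8). [RevuzYor1999]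
* G. F. Lawler, O. Schramm, W. Werner, Acta Math. **187** (2001), Thm. 2.2. [LawlerSchrammWerner2001]
-/

noncomputable section

open Set Filter Metric Function MeasureTheory ProbabilityTheory
open _root_.Complex _root_.Topology
open Literature.Probability.Process (brownian preWienerMeasure runSup)
open scoped NNReal

namespace Literature.Probability.RandomPlanarGeometry

open Loewner PathOps

/-! ### Gaussian tail of the bad event and moments on it -/

section Tail

/-- **`𝟙_E · X² ≤ λ² 𝟙_E + X⁴/λ²`** for `λ > 0`. [folklore] -/
theorem indicator_mul_sq_le_add_pow_four {Ω : Type*} (E : Set Ω) (X : Ω → ℝ) {l : ℝ} (hl : 0 < l) (ω : Ω) :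
    E.indicator (fun _ ↦ (1 : ℝ)) ω * X ω ^ 2 ≤ l ^ 2 * E.indicator (fun _ ↦ (1 : ℝ)) ω + X ω ^ 4 / l ^ 2 := by
  have h4 : 0 ≤ X ω ^ 4 / l ^ 2 := by positivity
  by_cases h : ω ∈ E
  · rw [Set.indicator_of_mem h, one_mul, mul_one]
    rcases le_or_gt (X ω ^ 2) (l ^ 2) with hle | hlt
    · linarith
    · have : X ω ^ 2 ≤ X ω ^ 4 / l ^ 2 := by
        rw [le_div_iff₀ (pow_pos hl 2)]
        calc X ω ^ 2 * l ^ 2 ≤ X ω ^ 2 * X ω ^ 2 := mul_le_mul_of_nonneg_left hlt.le (sq_nonneg _)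
          _ = X ω ^ 4 := by ring
      linarith [sq_nonneg l]
  · rw [Set.indicator_of_notMem h, zero_mul, mul_zero, zero_add]; exact h4

variable [MeasurableSpace C(ℝ≥0, ℝ)] [BorelSpace C(ℝ≥0, ℝ)]

/-- **Gaussian tail of the oscillation over a cell, polynomial form**: for `0 < a`, `0 < h`,
`P(a ≤ osc_h(incr_u β)) ≤ 768 h⁴/a⁸` (`2 exp(−a²/(2h))` and `e^{-y} ≤ 24/y⁴`).
[cite: RevuzYor1999, Ch. II Prop. (1.8)] -/
theorem measureReal_oscFn_incr_ge_le_pow_four (h u : ℝ≥0) {a : ℝ} (ha : 0 < a) (hh0 : 0 < h) :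
    preWienerMeasure.real {ω | a ≤ oscFn h (incr u (brownianCPath ω))} ≤ 768 * (h : ℝ) ^ 4 / a ^ 8 := by
  have hh0' : (0 : ℝ) < h := by exact_mod_cast hh0
  have h1 : preWienerMeasure {ω | a ≤ oscFn h (incr u (brownianCPath ω))} ≤ ENNReal.ofReal (2 * Real.exp (-a ^ 2 / (2 * h))) := by
    rw [measure_oscFn_incr_eq]; exact measure_le_runSup_le_exp h ha
  have hy : 0 < a ^ 2 / (2 * h) := by positivity
  -- `e^{-y} ≤ 24/y⁴` for `y > 0` (the exponential dominates `y⁴/4!`)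
  have hexp : Real.exp (-(a ^ 2 / (2 * h))) ≤ 24 / (a ^ 2 / (2 * h)) ^ 4 := by
    have hfac := Real.pow_div_factorial_le_exp (x := a ^ 2 / (2 * h)) hy.le 4
    rw [show ((Nat.factorial 4 : ℕ) : ℝ) = 24 by norm_num [Nat.factorial]] at hfac
    rw [Real.exp_neg, inv_eq_one_div, div_le_div_iff₀ (Real.exp_pos _) (by positivity)]
    have := (div_le_iff₀ (by norm_num : (0 : ℝ) < 24)).1 hfac
    linarith
  have h2 : 2 * Real.exp (-a ^ 2 / (2 * h)) ≤ 768 * (h : ℝ) ^ 4 / a ^ 8 := by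
    have := hexp
    rw [neg_div] 
    have e : 24 / (a ^ 2 / (2 * (h : ℝ))) ^ 4 = 384 * (h : ℝ) ^ 4 / a ^ 8 := by
      field_simp; ring
    rw [e] at this
    have : 2 * Real.exp (-(a ^ 2 / (2 * h))) ≤ 2 * (384 * (h : ℝ) ^ 4 / a ^ 8) := by linarith
    refine this.trans (le_of_eq ?_); ring
  rw [measureReal_def]
  calc (preWienerMeasure {ω | a ≤ oscFn h (incr u (brownianCPath ω))}).toReal ≤ (ENNReal.ofReal (2 * Real.exp (-a ^ 2 / (2 * h)))).toReal :=
        ENNReal.toReal_mono ENNReal.ofReal_ne_top h1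
    _ = 2 * Real.exp (-a ^ 2 / (2 * h)) := ENNReal.toReal_ofReal (by positivity)
    _ ≤ _ := h2

/-- **Moments of the running supremum on the bad event**: for `0 < a`, `0 < h`, with `X = runSup (u+h)`,
`l = 1/h`: `E[𝟙_{a ≤ osc} X] ≤ 768 h³/a⁸ + 18 (u+h)² h³` and `E[𝟙_{a ≤ osc} X²] ≤ 768 h²/a⁸ + 18 (u+h)² h²`
(and both products are integrable). [folklore] -/
theorem integral_indicator_oscFn_mul_runSup_pow_le (h u : ℝ≥0) {a : ℝ} (ha : 0 < a) (hh0 : 0 < h) :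
    Integrable (fun ω ↦ {ω | a ≤ oscFn h (incr u (brownianCPath ω))}.indicator (fun _ ↦ (1 : ℝ)) ω * runSup (u + h) ω) preWienerMeasure ∧
    Integrable (fun ω ↦ {ω | a ≤ oscFn h (incr u (brownianCPath ω))}.indicator (fun _ ↦ (1 : ℝ)) ω * runSup (u + h) ω ^ 2) preWienerMeasure ∧
    ∫ ω, {ω | a ≤ oscFn h (incr u (brownianCPath ω))}.indicator (fun _ ↦ (1 : ℝ)) ω * runSup (u + h) ω ∂preWienerMeasure ≤
      768 * (h : ℝ) ^ 3 / a ^ 8 + 18 * ((u + h : ℝ≥0) : ℝ) ^ 2 * h ^ 3 ∧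
    ∫ ω, {ω | a ≤ oscFn h (incr u (brownianCPath ω))}.indicator (fun _ ↦ (1 : ℝ)) ω * runSup (u + h) ω ^ 2 ∂preWienerMeasure ≤
      768 * (h : ℝ) ^ 2 / a ^ 8 + 18 * ((u + h : ℝ≥0) : ℝ) ^ 2 * h ^ 2 := by
  haveI := isProbabilityMeasure_preWienerMeasure'
  have hh0' : (0 : ℝ) < h := by exact_mod_cast hh0
  set E : Set (ℝ≥0 → ℝ) := {ω | a ≤ oscFn h (incr u (brownianCPath ω))} with hE
  have hEm : MeasurableSet E := measurableSet_le measurable_const ((measurable_oscFn h).comp ((measurable_incr u).comp measurable_brownianCPath))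
  have hIm : Measurable (E.indicator fun _ ↦ (1 : ℝ)) := measurable_const.indicator hEm
  have hX4 := Process.integrable_runSup_pow_four (u + h)
  have hX4le := Process.integral_runSup_pow_four_le (u + h)
  have hXm := Process.measurable_runSup (u + h)
  have hI1 : Integrable (E.indicator fun _ ↦ (1 : ℝ)) preWienerMeasure := (integrable_const (1 : ℝ)).indicator hEm
  have hP : preWienerMeasure.real E ≤ 768 * (h : ℝ) ^ 4 / a ^ 8 := measureReal_oscFn_incr_ge_le_pow_four h u ha hh0
  set l : ℝ := 1 / h with hl
  have hl0 : 0 < l := by positivity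
  -- first moment on the bad event
  have hb1 : ∀ ω, ‖E.indicator (fun _ ↦ (1 : ℝ)) ω * runSup (u + h) ω‖ ≤ l * E.indicator (fun _ ↦ (1 : ℝ)) ω + runSup (u + h) ω ^ 4 / l ^ 3 := by
    intro ω
    have h0 : 0 ≤ E.indicator (fun _ ↦ (1 : ℝ)) ω * runSup (u + h) ω :=
      mul_nonneg (Set.indicator_nonneg (fun _ _ ↦ zero_le_one) ω) (Process.runSup_nonneg _ ω)
    rw [Real.norm_eq_abs, abs_of_nonneg h0]
    exact indicator_mul_le_add_pow_four E (fun ω ↦ Process.runSup_nonneg (u + h) ω) hl0 ω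
  have hd1 : Integrable (fun ω ↦ l * E.indicator (fun _ ↦ (1 : ℝ)) ω + runSup (u + h) ω ^ 4 / l ^ 3) preWienerMeasure :=
    (hI1.const_mul l).add (hX4.div_const _)
  have i1 : Integrable (fun ω ↦ E.indicator (fun _ ↦ (1 : ℝ)) ω * runSup (u + h) ω) preWienerMeasure :=
    hd1.mono' (hIm.mul hXm).aestronglyMeasurable (Eventually.of_forall hb1)
  -- second moment on the bad event
  have hb2 : ∀ ω, ‖E.indicator (fun _ ↦ (1 : ℝ)) ω * runSup (u + h) ω ^ 2‖ ≤ l ^ 2 * E.indicator (fun _ ↦ (1 : ℝ)) ω + runSup (u + h) ω ^ 4 / l ^ 2 := by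
    intro ω
    have h0 : 0 ≤ E.indicator (fun _ ↦ (1 : ℝ)) ω * runSup (u + h) ω ^ 2 :=
      mul_nonneg (Set.indicator_nonneg (fun _ _ ↦ zero_le_one) ω) (sq_nonneg _)
    rw [Real.norm_eq_abs, abs_of_nonneg h0]
    exact indicator_mul_sq_le_add_pow_four E (fun ω ↦ runSup (u + h) ω) hl0 ω
  have hd2 : Integrable (fun ω ↦ l ^ 2 * E.indicator (fun _ ↦ (1 : ℝ)) ω + runSup (u + h) ω ^ 4 / l ^ 2) preWienerMeasure :=
    (hI1.const_mul _).add (hX4.div_const _)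
  have i2 : Integrable (fun ω ↦ E.indicator (fun _ ↦ (1 : ℝ)) ω * runSup (u + h) ω ^ 2) preWienerMeasure :=
    hd2.mono' (hIm.mul (hXm.pow_const 2)).aestronglyMeasurable (Eventually.of_forall hb2)
  refine ⟨i1, i2, ?_, ?_⟩
  · calc ∫ ω, E.indicator (fun _ ↦ (1 : ℝ)) ω * runSup (u + h) ω ∂preWienerMeasure
        ≤ ∫ ω, (l * E.indicator (fun _ ↦ (1 : ℝ)) ω + runSup (u + h) ω ^ 4 / l ^ 3) ∂preWienerMeasure :=
          integral_mono i1 hd1 fun ω ↦ (le_abs_self _).trans (by have := hb1 ω; rwa [Real.norm_eq_abs] at this)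
      _ = l * preWienerMeasure.real E + (∫ ω, runSup (u + h) ω ^ 4 ∂preWienerMeasure) / l ^ 3 := by
          rw [integral_add (hI1.const_mul l) (hX4.div_const _), integral_const_mul, integral_indicator_const _ hEm, integral_div]
          simp
      _ ≤ l * (768 * (h : ℝ) ^ 4 / a ^ 8) + 18 * ((u + h : ℝ≥0) : ℝ) ^ 2 / l ^ 3 := by gcongr
      _ = _ := by rw [hl]; field_simp
  · calc ∫ ω, E.indicator (fun _ ↦ (1 : ℝ)) ω * runSup (u + h) ω ^ 2 ∂preWienerMeasure
        ≤ ∫ ω, (l ^ 2 * E.indicator (fun _ ↦ (1 : ℝ)) ω + runSup (u + h) ω ^ 4 / l ^ 2) ∂preWienerMeasure :=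
          integral_mono i2 hd2 fun ω ↦ (le_abs_self _).trans (by have := hb2 ω; rwa [Real.norm_eq_abs] at this)
      _ = l ^ 2 * preWienerMeasure.real E + (∫ ω, runSup (u + h) ω ^ 4 ∂preWienerMeasure) / l ^ 2 := by
          rw [integral_add (hI1.const_mul _) (hX4.div_const _), integral_const_mul, integral_indicator_const _ hEm, integral_div]
          simp
      _ ≤ l ^ 2 * (768 * (h : ℝ) ^ 4 / a ^ 8) + 18 * ((u + h : ℝ≥0) : ℝ) ^ 2 / l ^ 2 := by gcongr
      _ = _ := by rw [hl]; field_simp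

end Tail

end Literature.Probability.RandomPlanarGeometry

end
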